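import Mathlib

/-! # ONE-PAIR TOY (lens-1 g2): the READY ⁄ LANDING-DIP ⁄ NEWTON trichotomy with exact thresholds `λ = 1` and `λ = √2`

Model level function near a LOW conjugate pair `X ± iy` under a CONSTANT external tilt `L > 0` (translate `X = 0`):
`F t = (t² + y²)·e^{Lt}`, tilt parameter `λ := L·y`.  Closed forms: `F′ = e^{Lt}(Lt² + 2t + Ly²)`, `F″ = e^{Lt}((Lt+2)² − (2 − λ²))`,
`F‴ = e^{Lt}(L((Lt+2)² − (2−λ²)) + 2L(Lt+2))`.
* `λ < 1` (WEAK tilt): `F′` vanishes at `t₊ = (−1 + √(1−λ²))/L` with `F·F″ > 0` there — a non-Laguerre DIP of `F` = READY (out of the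
  SUCC law's scope).                                                                                     (`ready_of_weak_tilt`)
* `1 < λ < √2` (LANDING band): `F′ > 0` everywhere (no critical point), and at the inflection `t₁ = (−2 + √(2−λ²))/L` one has `F″ = 0`,
  `F′ > 0`, `F‴ > 0` — a NON-CROSSING DIP of `F′` (the coverage cell datum `LandingDip`, with `−2y < t₁ < 0`, i.e. inside the localisation
  `|xs − X| < 2y`); the Jensen dip lemma (`Lens1_JensenDip.lean`) then puts `t₁` inside the Jensen disc of a zero of `F′` — here the child
  `−y/λ ± iy√(1−1/λ²)`.                                                                    (`landingDip_of_mid_tilt`, `dip_location`)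
* `√2 < λ` (NEWTON band): `F″ > 0` everywhere — `F′` is strictly increasing, NO dip; `‖K‖y = √(λ² + 1/4) > 3/2`, the Newton door's regime.
                                                                                                          (`convex_of_strong_tilt`)
So in the one-pair model the scope of the SUCC law (`λ ≥ 1`) is the union LANDING-DIP `(1, √2)` ∪ NEWTON `[√2, ∞)`, the landing band being
exactly where a SIGN (no margin) certifies the successor.  OBSERVABLE for the census: `λ_row := Im v · |Re K_ext(v)|`.
Toy only; nothing here bears on the truth of RH; RH is not proved; 33346/33347 OPEN. -/

namespace RhW08.Lens1OnePairToy

open Real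

noncomputable section

/-- The model and its first three derivatives in closed form. -/
def F (L y t : ℝ) : ℝ := (t ^ 2 + y ^ 2) * exp (L * t)
def F1 (L y t : ℝ) : ℝ := exp (L * t) * (L * t ^ 2 + 2 * t + L * y ^ 2)
def F2 (L y t : ℝ) : ℝ := exp (L * t) * ((L * t + 2) ^ 2 - (2 - (L * y) ^ 2))
def F3 (L y t : ℝ) : ℝ := exp (L * t) * (L * ((L * t + 2) ^ 2 - (2 - (L * y) ^ 2)) + 2 * L * (L * t + 2))

theorem hasDerivAt_F (L y t : ℝ) : HasDerivAt (F L y) (F1 L y t) t := by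
  have h1 : HasDerivAt (fun t => t ^ 2 + y ^ 2) (2 * t) t := by
    simpa using (hasDerivAt_pow 2 t).add_const (y ^ 2)
  have h2 : HasDerivAt (fun t => exp (L * t)) (exp (L * t) * L) t := by
    simpa using ((hasDerivAt_id t).const_mul L).exp
  have h := h1.mul h2
  refine h.congr_deriv ?_
  simp only [F1]; ring

theorem hasDerivAt_F1 (L y t : ℝ) : HasDerivAt (F1 L y) (F2 L y t) t := by
  have h2 : HasDerivAt (fun t => exp (L * t)) (exp (L * t) * L) t := by
    simpa using ((hasDerivAt_id t).const_mul L).exp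
  have h3 : HasDerivAt (fun t => L * t ^ 2 + 2 * t + L * y ^ 2) (L * (2 * t) + 2) t := by
    have := (((hasDerivAt_pow 2 t).const_mul L).add ((hasDerivAt_id t).const_mul 2)).add_const (L * y ^ 2)
    simpa using this
  have h := h2.mul h3
  refine h.congr_deriv ?_
  simp only [F2]; ring

theorem hasDerivAt_F2 (L y t : ℝ) : HasDerivAt (F2 L y) (F3 L y t) t := by
  have h2 : HasDerivAt (fun t => exp (L * t)) (exp (L * t) * L) t := by
    simpa using ((hasDerivAt_id t).const_mul L).exp
  have h3 : HasDerivAt (fun t => (L * t + 2) ^ 2 - (2 - (L * y) ^ 2)) (2 * (L * t + 2) * L) t := by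
    have hlin : HasDerivAt (fun t => L * t + 2) L t := by
      simpa using ((hasDerivAt_id t).const_mul L).add_const 2
    have := (hlin.pow 2).sub_const (2 - (L * y) ^ 2)
    simpa using this
  have h := h2.mul h3
  refine h.congr_deriv ?_
  simp only [F3]; ring

/-- ★ WEAK TILT `λ < 1` ⇒ READY: `F` has a non-Laguerre dip (`F′ = 0`, `F·F″ > 0`) at `t₊ = (−1 + √(1 − λ²))/L`. -/
theorem ready_of_weak_tilt {L y : ℝ} (hL : 0 < L) (hy : 0 < y) (hweak : L * y < 1) :
    ∃ t : ℝ, F1 L y t = 0 ∧ 0 < F L y t * F2 L y t := by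
  set q := Real.sqrt (1 - (L * y) ^ 2) with hq
  have hq0 : 0 < q := Real.sqrt_pos.mpr (by nlinarith [mul_pos hL hy])
  have hqq : q ^ 2 = 1 - (L * y) ^ 2 := Real.sq_sqrt (by nlinarith [mul_pos hL hy])
  refine ⟨(-1 + q) / L, ?_, ?_⟩
  · simp only [F1]
    have : L * ((-1 + q) / L) ^ 2 + 2 * ((-1 + q) / L) + L * y ^ 2 = 0 := by
      field_simp
      nlinarith [hqq]
    rw [this, mul_zero]
  · simp only [F, F2]
    have hlin : L * ((-1 + q) / L) + 2 = 1 + q := by field_simp; ring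
    rw [hlin]
    have hpos1 : 0 < ((-1 + q) / L) ^ 2 + y ^ 2 := by positivity
    have hpos2 : 0 < (1 + q) ^ 2 - (2 - (L * y) ^ 2) := by nlinarith [hqq]
    have := mul_pos (mul_pos hpos1 (exp_pos (L * ((-1 + q) / L)))) (mul_pos (exp_pos (L * ((-1 + q) / L))) hpos2)
    linarith [this]

/-- ★ MID TILT `1 < λ < √2` ⇒ LANDING DIP of `F′`: at `t₁ = (−2 + √(2 − λ²))/L`, `F″ = 0`, `F′ > 0`, `F‴ > 0` (so `F′·F‴ > 0`). -/
theorem landingDip_of_mid_tilt {L y : ℝ} (hL : 0 < L) (hlo : 1 < L * y) (hhi : (L * y) ^ 2 < 2) :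
    ∃ t : ℝ, F2 L y t = 0 ∧ 0 < F1 L y t ∧ 0 < F3 L y t := by
  set q := Real.sqrt (2 - (L * y) ^ 2) with hq
  have hq0 : 0 < q := Real.sqrt_pos.mpr (by linarith)
  have hqq : q ^ 2 = 2 - (L * y) ^ 2 := Real.sq_sqrt (by linarith)
  refine ⟨(-2 + q) / L, ?_, ?_, ?_⟩
  · simp only [F2]
    have hlin : L * ((-2 + q) / L) + 2 = q := by field_simp; ring
    rw [hlin, hqq, sub_self, mul_zero]
  · simp only [F1]
    refine mul_pos (exp_pos _) ?_
    have e : L * ((-2 + q) / L) ^ 2 + 2 * ((-2 + q) / L) + L * y ^ 2 = ((-2 + q + 1) ^ 2 + ((L * y) ^ 2 - 1)) / L := by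
      field_simp; ring
    rw [e]
    exact div_pos (by nlinarith [sq_nonneg (-2 + q + 1)]) hL
  · simp only [F3]
    refine mul_pos (exp_pos _) ?_
    have hlin : L * ((-2 + q) / L) + 2 = q := by field_simp; ring
    rw [hlin, hqq, sub_self, mul_zero, zero_add]
    positivity

/-- The landing dip sits at `t₁ ∈ (−2y, 0)` — inside the coverage's localisation `|xs − X| < 2·y` (and left of `X`, downhill of the tilt). -/
theorem dip_location {L y : ℝ} (hL : 0 < L) (hlo : 1 < L * y) (hhi : (L * y) ^ 2 < 2) :
    -(2 * y) < (-2 + Real.sqrt (2 - (L * y) ^ 2)) / L ∧ (-2 + Real.sqrt (2 - (L * y) ^ 2)) / L < 0 := by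
  set q := Real.sqrt (2 - (L * y) ^ 2) with hq
  have hq0 : 0 < q := Real.sqrt_pos.mpr (by linarith)
  have hqq : q ^ 2 = 2 - (L * y) ^ 2 := Real.sq_sqrt (by linarith)
  have hq1 : q < 1 := by nlinarith [hqq]
  constructor
  · rw [lt_div_iff₀ hL]; nlinarith
  · rw [div_lt_iff₀ hL]; linarith

/-- ★ STRONG TILT `√2 < λ` ⇒ NO DIP: `F″ > 0` everywhere (`F′` strictly increasing) — the Newton band. -/
theorem convex_of_strong_tilt {L y : ℝ} (hstrong : 2 < (L * y) ^ 2) (t : ℝ) : 0 < F2 L y t := by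
  simp only [F2]
  exact mul_pos (exp_pos _) (by nlinarith [sq_nonneg (L * t + 2)])

/-- In the scope of the SUCC law (`1 ≤ λ`, i.e. not READY by weak tilt) `F′` never vanishes: no real child, the pair's children are the
non-real `(−y ± i·y·√(λ² − 1))/λ`-points — recorded here as `F′ > 0`. -/
theorem deriv_pos_of_scope {L y : ℝ} (hL : 0 < L) (hlo : 1 < L * y) (t : ℝ) : 0 < F1 L y t := by
  simp only [F1]
  refine mul_pos (exp_pos _) ?_
  have e : L * t ^ 2 + 2 * t + L * y ^ 2 = ((L * t + 1) ^ 2 + ((L * y) ^ 2 - 1)) / L := by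
    field_simp; ring
  rw [e]
  exact div_pos (by nlinarith [sq_nonneg (L * t + 1)]) hL

end

end RhW08.Lens1OnePairToy
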